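import Literature.AlgebraicGeometry.Resolution.EffectiveResolutionKollarLeaves
import Literature.AlgebraicGeometry.Resolution.KollarBlowupSequenceFunctorsProofs
import HarnessLib

/-!
# `BierstoneGrigorievMilmanWlodarczyk2011` rests on the single leaf `Kollar2007Thm3_107` (Kollár 2007, Thm. 3.107)

Topic: `Literature/AlgebraicGeometry/Resolution`. Bookkeeping file on the line discharging the
named fact `BierstoneGrigorievMilmanWlodarczyk2011` (`EffectiveResolution.lean`: Bierstone–
Grigoriev–Milman–Włodarczyk, arXiv:1206.3090, Cor. 8.0.6 in the weak non-embedded form for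
integral affine `Y ⊆ 𝔸ⁿ_k`, `k` perfect of characteristic `p > M(d, n, l)`; journal numbering
Cor. 7.0.6).

`EffectiveResolutionKollarLeaves.lean` PROVES
`bierstoneGrigorievMilmanWlodarczyk2011_of_kollarThms :
  Kollar2007Thm3_103.{0} → Kollar2007Thm3_107.{0} → BierstoneGrigorievMilmanWlodarczyk2011`
(resolution of marked ideals in characteristic zero by Kollár's induction 3.70 from its two
inductive steps, spread out over `Spec ℤ[c]` and pushed to every prime of large residue
characteristic by Noetherian induction), and `KollarBlowupSequenceFunctorsProofs.lean` now PROVES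
the first leaf, `Kollar2007Thm3_103_holds` (Kollár's Thm. 3.103: order reduction for marked
ideals in dimensions `< n` ⟹ order reduction for ideals in dimension `n`; 3.104, 3.102, 3.92,
3.97, 3.99, 3.105). This file records the composite, so that the large-characteristic fact
visibly rests on exactly ONE named fact, `Kollar2007Thm3_107` (Kollár's Thm. 3.107 = (3.70.2):
order reduction for ideals in dimension `n` ⟹ order reduction for marked ideals in dimension
`n`, §3.13 of the book), PROVED here, no new named fact:

* `bierstoneGrigorievMilmanWlodarczyk2011_of_kollarThm3_107` —
  **`Kollar2007Thm3_107.{0} → BierstoneGrigorievMilmanWlodarczyk2011`**.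

Hence `BierstoneGrigorievMilmanWlodarczyk2011_holds` is the one-liner
`bierstoneGrigorievMilmanWlodarczyk2011_of_kollarThm3_107 Kollar2007Thm3_107_holds` once that
leaf is discharged (to be appended to this file).

## Sources

* E. Bierstone, D. Grigoriev, P. Milman, J. Włodarczyk, *Effective Hironaka resolution and its
  complexity (with appendix on applications in positive characteristic)*, Asian J. Math. 15
  (2011) / arXiv:1206.3090, Cor. 8.0.6 (held-text numbering, as in `EffectiveResolution.lean`;
  journal Cor. 7.0.6). [BierstoneGrigorievMilmanWlodarczyk2011]
* J. Kollár, *Lectures on Resolution of Singularities*, Ann. of Math. Stud. 166 (2007), 3.70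
  (p. 150), Thm. 3.69 (p. 150), Thm. 3.103 (p. 171), Thm. 3.107 (p. 175). [Kollar2007]
-/

namespace Literature.AlgebraicGeometry.Resolution

/-- **`BierstoneGrigorievMilmanWlodarczyk2011` from Kollár's Thm. 3.107 alone** (at universe
`0`): Kollár's Thm. 3.103 is proved in the tree (`Kollar2007Thm3_103_holds`), so the two-leaf
reduction `bierstoneGrigorievMilmanWlodarczyk2011_of_kollarThms` (induction 3.70 ⟹ Thm. 3.69 in
every dimension ⟹ resolution of marked ideals on affine space in characteristic zero ⟹ the
large-characteristic statement by spreading out and Noetherian induction) needs only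
Thm. 3.107. After this theorem the large-characteristic fact rests on exactly the named fact
`Kollar2007Thm3_107`.
[cite: Kollar2007, 3.70, Thm. 3.103 (p. 171), Thm. 3.107 (p. 175)]
[cite: BierstoneGrigorievMilmanWlodarczyk2011, Cor. 8.0.6] -/
theorem bierstoneGrigorievMilmanWlodarczyk2011_of_kollarThm3_107 (h107 : Kollar2007Thm3_107.{0}) :
    BierstoneGrigorievMilmanWlodarczyk2011 :=
  bierstoneGrigorievMilmanWlodarczyk2011_of_kollarThms Kollar2007Thm3_103_holds h107

end Literature.AlgebraicGeometry.Resolution
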